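import Mathlib.Analysis.Calculus.ContDiff.Bounds
import Mathlib.Analysis.Calculus.IteratedDeriv.Lemmas
import Mathlib.Analysis.SpecialFunctions.ExpDeriv
import Mathlib.Analysis.InnerProductSpace.PiL2
import Literature.Analysis.Calculus.SeeleyExtension
import HarnessLib

/-!
# Crux `MixingPayoff` (stmt-NavierStokesRegularity-1422), line `birth`, stub W2
  (`stub_advectionDiffusionSchwartz`): an exponential weight with bounded derivatives

Helper file (lands `--supports stmt-NavierStokesRegularity-1422`). On a finite-dimensional
real inner product space `E` of dimension `d` there is a smooth weight `wt : E → ℝ` with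

* `‖x‖ − d ≤ wt(x)` (linear growth),
* all derivatives of order `≥ 1` bounded,
* `‖Dⁿ e^{−wt}(x)‖ ≤ Cₙ e^{−wt(x)}` for every `n`

(`exists_weight`). It is `wt(x) = Σᵢ ρ(⟪bᵢ, x⟫)` along an orthonormal basis, with the smoothed
absolute value `ρ(s) = s (2φ(s) − 1)`, `φ` the cutoff of the tree's Seeley file
(`Seeley.cutoff`, `= 0` for `s ≤ −1/2`, `= 1` for `s ≥ −1/4`, all derivatives bounded by
`Seeley.cutoffBound`). Conjugating the advection–diffusion equation by `e^{wt}` turns Gaussian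
decay of the solution into boundedness, which is how stub W2 obtains the Schwartz-type decay of
all derivatives from the `C_b^∞` theory.
-/

noncomputable section

open Set Function Filter Topology
open scoped ContDiff Topology InnerProductSpace Nat

-- `Summit = Problem` for this summit; the tree lakefile sets `weak.linter.dupNamespace = false`.
set_option linter.dupNamespace false

namespace Summit.NavierStokesRegularity.NavierStokesRegularity.Theorems.SelfMixingDichotomy.MixingPayoffBirth

open Literature.Analysis.Calculus Literature.Analysis.Calculus.Seeley

/-! ### The one-dimensional profile -/

/-- Iterated derivatives of positive order of a continuous linear map are bounded by its norm. -/
theorem norm_iteratedFDeriv_clm_succ_le {X Y : Type*} [NormedAddCommGroup X] [NormedSpace ℝ X]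
    [NormedAddCommGroup Y] [NormedSpace ℝ Y] (A : X →L[ℝ] Y) (n : ℕ) (x : X) :
    ‖iteratedFDeriv ℝ (n + 1) A x‖ ≤ ‖A‖ := by
  rw [← norm_iteratedFDeriv_fderiv, show fderiv ℝ (⇑A) = fun _ => A from funext fun y => A.fderiv]
  rcases n with _ | n
  · simp
  · rw [iteratedFDeriv_const_of_ne (by omega)]
    simp

/-- The sign profile `g = 2φ − 1`: `|g| ≤ 1`. -/
theorem abs_profileSign_le (s : ℝ) : |2 * Seeley.cutoff s - 1| ≤ 1 := by
  have h0 := Seeley.cutoff_nonneg s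
  have h1 := Seeley.cutoff_le_one s
  rw [abs_le]; constructor <;> linarith

/-- The derivatives of positive order of `g = 2φ − 1` are bounded by `2 K_k`. -/
theorem norm_iteratedFDeriv_profileSign_le (k : ℕ) (s : ℝ) :
    ‖iteratedFDeriv ℝ (k + 1) (fun s => 2 * Seeley.cutoff s - 1) s‖ ≤ 2 * Seeley.cutoffBound (k + 1) := by
  have hc : ContDiff ℝ ∞ Seeley.cutoff := Seeley.contDiff_cutoff
  have h2 : ContDiffAt ℝ (↑(k + 1)) ((2 : ℝ) • Seeley.cutoff) s :=
    (hc.const_smul (2 : ℝ)).contDiffAt.of_le (mod_cast le_top)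
  rw [show (fun s => 2 * Seeley.cutoff s - 1) = ((2 : ℝ) • Seeley.cutoff) - fun _ => (1 : ℝ) from by
      funext s; simp,
    iteratedFDeriv_sub_apply h2 (contDiff_const.contDiffAt.of_le (mod_cast le_top)),
    iteratedFDeriv_const_of_ne (by omega), Pi.zero_apply, sub_zero,
    iteratedFDeriv_const_smul_apply (hc.contDiffAt.of_le (mod_cast le_top)), norm_smul]
  simp only [Real.norm_eq_abs, Nat.abs_ofNat]
  exact mul_le_mul_of_nonneg_left (Seeley.norm_iteratedFDeriv_cutoff_le _ _) (by norm_num)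

/-- The derivatives of positive order of `g = 2φ − 1` vanish off `[−1/2, −1/4]`. -/
theorem iteratedFDeriv_profileSign_eq_zero {k : ℕ} {s : ℝ} (hs : s < -1 / 2 ∨ -1 / 4 < s) :
    iteratedFDeriv ℝ (k + 1) (fun s => 2 * Seeley.cutoff s - 1) s = 0 := by
  rcases hs with hs | hs
  · have hev : (fun s => 2 * Seeley.cutoff s - 1) =ᶠ[𝓝 s] fun _ => (-1 : ℝ) := by
      filter_upwards [Iio_mem_nhds hs] with r hr
      rw [Seeley.cutoff_of_le (le_of_lt hr)]; norm_num
    rw [(hev.iteratedFDeriv ℝ (k + 1)).eq_of_nhds, iteratedFDeriv_const_of_ne (by omega)]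
    rfl
  · have hev : (fun s => 2 * Seeley.cutoff s - 1) =ᶠ[𝓝 s] fun _ => (1 : ℝ) := by
      filter_upwards [Ioi_mem_nhds hs] with r hr
      rw [Seeley.cutoff_of_ge (le_of_lt hr)]; norm_num
    rw [(hev.iteratedFDeriv ℝ (k + 1)).eq_of_nhds, iteratedFDeriv_const_of_ne (by omega)]
    rfl

/-- **The smoothed absolute value `ρ(s) = s(2φ(s) − 1)` has bounded derivatives of every
positive order.** -/
theorem norm_iteratedFDeriv_profile_le (n : ℕ) :
    ∃ C, ∀ s : ℝ, ‖iteratedFDeriv ℝ (n + 1) (fun s => s * (2 * Seeley.cutoff s - 1)) s‖ ≤ C := by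
  have hg : ContDiff ℝ ∞ fun s => 2 * Seeley.cutoff s - 1 :=
    (contDiff_const.mul Seeley.contDiff_cutoff).sub contDiff_const
  set K : ℝ := 1 + 2 * ∑ j ∈ Finset.range (n + 2), Seeley.cutoffBound j with hK
  have hK1 : ∀ j ≤ n + 1, 2 * Seeley.cutoffBound j ≤ K := by
    intro j hj
    have h := Finset.single_le_sum (f := fun j => Seeley.cutoffBound j) (fun i _ => Seeley.cutoffBound_nonneg i)
      (Finset.mem_range.2 (Nat.lt_succ_of_le hj))
    rw [hK]; linarith
  have hK0 : 0 ≤ K := by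
    have := Finset.sum_nonneg fun j (_ : j ∈ Finset.range (n + 2)) => Seeley.cutoffBound_nonneg j
    rw [hK]; linarith
  -- bounds for the two factors
  have hgb : ∀ i ≤ n + 1, ∀ s : ℝ, ‖iteratedFDeriv ℝ i (fun s => 2 * Seeley.cutoff s - 1) s‖ ≤ K := by
    intro i hi s
    rcases i with _ | i
    · rw [norm_iteratedFDeriv_zero, Real.norm_eq_abs]
      refine (abs_profileSign_le s).trans ?_
      have := Finset.sum_nonneg fun j (_ : j ∈ Finset.range (n + 2)) => Seeley.cutoffBound_nonneg j
      rw [hK]; linarith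
    · exact (norm_iteratedFDeriv_profileSign_le i s).trans (hK1 _ hi)
  refine ⟨∑ i ∈ Finset.range (n + 2), ((n + 1).choose i : ℝ) * K, fun s => ?_⟩
  have h := norm_iteratedFDeriv_mul_le (contDiff_id (𝕜 := ℝ) (E := ℝ)) hg s (n := n + 1)
    (mod_cast le_top)
  refine h.trans (Finset.sum_le_sum fun i hi => ?_)
  have hin : i ≤ n + 1 := Nat.lt_succ_iff.1 (Finset.mem_range.1 hi)
  rw [mul_assoc]
  refine mul_le_mul_of_nonneg_left ?_ (by positivity)
  rcases i with _ | i
  · -- the term `|s| ‖D^{n+1} g (s)‖`: the derivative vanishes unless `|s| ≤ 1/2`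
    simp only [Nat.sub_zero, norm_iteratedFDeriv_zero, id_eq, Real.norm_eq_abs]
    by_cases hs : s < -1 / 2 ∨ -1 / 4 < s
    · rw [iteratedFDeriv_profileSign_eq_zero hs, norm_zero, mul_zero]; exact hK0
    · push Not at hs
      have hs' : |s| ≤ 1 := by rw [abs_le]; constructor <;> linarith [hs.1, hs.2]
      calc |s| * ‖iteratedFDeriv ℝ (n + 1) (fun s => 2 * Seeley.cutoff s - 1) s‖
          ≤ 1 * K := mul_le_mul hs' (hgb _ le_rfl s) (norm_nonneg _) zero_le_one
        _ = K := one_mul K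
  · have h1 : ‖iteratedFDeriv ℝ (i + 1) (id : ℝ → ℝ) s‖ ≤ 1 := by
      have := norm_iteratedFDeriv_clm_succ_le (ContinuousLinearMap.id ℝ ℝ) i s
      rw [ContinuousLinearMap.coe_id'] at this
      exact this.trans ContinuousLinearMap.norm_id_le
    calc ‖iteratedFDeriv ℝ (i + 1) (id : ℝ → ℝ) s‖ *
          ‖iteratedFDeriv ℝ (n + 1 - (i + 1)) (fun s => 2 * Seeley.cutoff s - 1) s‖
        ≤ 1 * K := mul_le_mul h1 (hgb _ (by omega) s) (norm_nonneg _) zero_le_one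
      _ = K := one_mul K

/-- `ρ(s) ≥ |s| − 1`. -/
theorem abs_sub_one_le_profile (s : ℝ) : |s| - 1 ≤ s * (2 * Seeley.cutoff s - 1) := by
  by_cases h1 : s ≤ -1 / 2
  · rw [Seeley.cutoff_of_le h1, abs_of_neg (by linarith)]; linarith
  by_cases h2 : -1 / 4 ≤ s
  · rw [Seeley.cutoff_of_ge h2]
    rcases le_or_gt 0 s with h | h
    · rw [abs_of_nonneg h]; linarith
    · rw [abs_of_neg h]; linarith
  · push Not at h1 h2
    have hg := abs_profileSign_le s
    have hs : |s| ≤ 1 / 2 := by rw [abs_le]; constructor <;> linarith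
    have : |s * (2 * Seeley.cutoff s - 1)| ≤ 1 / 2 := by
      rw [abs_mul]; nlinarith [abs_nonneg s, abs_nonneg (2 * Seeley.cutoff s - 1)]
    linarith [neg_abs_le (s * (2 * Seeley.cutoff s - 1))]

/-! ### The weight -/

/-- `ℓ¹ ≥ ℓ²` along an orthonormal basis: `‖x‖ ≤ Σᵢ |⟪bᵢ, x⟫|`. -/
theorem norm_le_sum_abs_inner {E : Type*} [NormedAddCommGroup E] [InnerProductSpace ℝ E]
    {ι : Type*} [Fintype ι] (b : OrthonormalBasis ι ℝ E) (x : E) :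
    ‖x‖ ≤ ∑ i, |⟪b i, x⟫_ℝ| := by
  have hS : 0 ≤ ∑ i, |⟪b i, x⟫_ℝ| := Finset.sum_nonneg fun i _ => abs_nonneg _
  have hsq : ‖x‖ ^ 2 ≤ (∑ i, |⟪b i, x⟫_ℝ|) ^ 2 := by
    rw [← b.sum_sq_inner_right x, sq, Finset.sum_mul]
    refine Finset.sum_le_sum fun i _ => ?_
    rw [sq, ← abs_mul_abs_self]
    exact mul_le_mul_of_nonneg_left (Finset.single_le_sum (f := fun j => |⟪b j, x⟫_ℝ|)
      (fun j _ => abs_nonneg _) (Finset.mem_univ i)) (abs_nonneg _)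
  exact (pow_le_pow_iff_left₀ (norm_nonneg x) hS two_ne_zero).1 hsq

set_option maxHeartbeats 800000 in
/-- **An exponential weight with bounded derivatives.** On a finite-dimensional real inner
product space of dimension `d` there is a smooth `wt` with `‖x‖ − d ≤ wt(x)`, all derivatives of
order `≥ 1` bounded, and `‖Dⁿ(e^{−wt})(x)‖ ≤ Cₙ e^{−wt(x)}` for every `n` (the last from the
bound for derivatives of a composition, `n! C Dⁿ`, with all derivatives of `exp` equal to
`exp`). -/
theorem exists_weight (E : Type*) [NormedAddCommGroup E] [InnerProductSpace ℝ E]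
    [FiniteDimensional ℝ E] : ∃ wt : E → ℝ, ContDiff ℝ ∞ wt ∧
      (∀ x, ‖x‖ - Module.finrank ℝ E ≤ wt x) ∧
      (∀ k, ∃ C, ∀ x, ‖iteratedFDeriv ℝ (k + 1) wt x‖ ≤ C) ∧
      (∀ n, ∃ C, ∀ x, ‖iteratedFDeriv ℝ n (fun x => Real.exp (-wt x)) x‖ ≤ C * Real.exp (-wt x)) := by
  set b := stdOrthonormalBasis ℝ E with hb
  set ρ : ℝ → ℝ := fun s => s * (2 * Seeley.cutoff s - 1) with hρ
  have hρs : ContDiff ℝ ∞ ρ := contDiff_id.mul ((contDiff_const.mul Seeley.contDiff_cutoff).sub contDiff_const)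
  set wt : E → ℝ := fun x => ∑ i, ρ (⟪b i, x⟫_ℝ) with hwt
  have hwti : ∀ i, ContDiff ℝ ∞ fun x => ρ (⟪b i, x⟫_ℝ) := fun i => hρs.comp (innerSL ℝ (b i)).contDiff
  have hwts : ContDiff ℝ ∞ wt := ContDiff.sum fun i _ => hwti i
  -- derivatives of order `≥ 1`
  have hwtb : ∀ k, ∃ C, ∀ x, ‖iteratedFDeriv ℝ (k + 1) wt x‖ ≤ C := by
    intro k
    obtain ⟨C, hC⟩ := norm_iteratedFDeriv_profile_le k
    have hC0 : 0 ≤ C := (norm_nonneg _).trans (hC 0)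
    refine ⟨∑ _i : Fin (Module.finrank ℝ E), C, fun x => ?_⟩
    have hsum : iteratedFDeriv ℝ (k + 1) wt x = ∑ i, iteratedFDeriv ℝ (k + 1) (fun x => ρ (⟪b i, x⟫_ℝ)) x := by
      have h := iteratedFDerivWithin_sum_apply (𝕜 := ℝ) (f := fun i x => ρ (⟪b i, x⟫_ℝ)) (u := Finset.univ)
        (i := k + 1) (x := x) uniqueDiffOn_univ (mem_univ _)
        (fun i _ => ((hwti i).of_le (mod_cast le_top)).contDiffWithinAt)
      simp only [iteratedFDerivWithin_univ] at h
      rw [← h]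
      congr 1
      funext y
      simp [hwt, Finset.sum_apply]
    rw [hsum]
    refine (norm_sum_le _ _).trans (Finset.sum_le_sum fun i _ => ?_)
    rw [show (fun x => ρ (⟪b i, x⟫_ℝ)) = ρ ∘ (innerSL ℝ (b i)) from rfl,
      (innerSL ℝ (b i)).iteratedFDeriv_comp_right hρs x (mod_cast le_top)]
    refine (ContinuousMultilinearMap.norm_compContinuousLinearMap_le _ _).trans ?_
    rw [Finset.prod_const, Finset.card_univ, Fintype.card_fin, innerSL_apply_norm, b.orthonormal.1 i,
      one_pow, mul_one]
    exact hC _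
  refine ⟨wt, hwts, fun x => ?_, hwtb, fun n => ?_⟩
  · -- linear growth
    have h1 : ∀ i, |⟪b i, x⟫_ℝ| - 1 ≤ ρ (⟪b i, x⟫_ℝ) := fun i => abs_sub_one_le_profile _
    have h2 : ∑ i, (|⟪b i, x⟫_ℝ| - 1) ≤ wt x := Finset.sum_le_sum fun i _ => h1 i
    rw [Finset.sum_sub_distrib, Finset.sum_const, Finset.card_univ, Fintype.card_fin, nsmul_eq_mul,
      mul_one] at h2
    linarith [norm_le_sum_abs_inner b x]
  · -- derivatives of `e^{−wt}`
    choose C hC using hwtb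
    set D : ℝ := 1 + ∑ j ∈ Finset.range n, |C j| with hD
    have hD1 : 1 ≤ D := by
      have := Finset.sum_nonneg fun j (_ : j ∈ Finset.range n) => abs_nonneg (C j)
      rw [hD]; linarith
    have hDi : ∀ i, 1 ≤ i → i ≤ n → ∀ x, ‖iteratedFDeriv ℝ i (fun x => -wt x) x‖ ≤ D ^ i := by
      intro i hi hin x
      obtain ⟨k, rfl⟩ : ∃ k, i = k + 1 := ⟨i - 1, by omega⟩
      rw [show (fun x => -wt x) = -wt from rfl, iteratedFDeriv_neg_apply, norm_neg]
      refine ((hC k x).trans (le_abs_self _)).trans ?_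
      have h1 : |C k| ≤ D := by
        have := Finset.single_le_sum (f := fun j => |C j|) (fun j _ => abs_nonneg _)
          (Finset.mem_range.2 (show k < n by omega))
        rw [hD]; linarith
      exact h1.trans (le_self_pow₀ hD1 (by omega))
    refine ⟨(n ! : ℝ) * D ^ n, fun x => ?_⟩
    have hexp : ∀ i, ‖iteratedFDeriv ℝ i Real.exp (-wt x)‖ = Real.exp (-wt x) := by
      intro i
      rw [norm_iteratedFDeriv_eq_norm_iteratedDeriv, iteratedDeriv_eq_iterate, Real.iter_deriv_exp,
        Real.norm_eq_abs, abs_of_pos (Real.exp_pos _)]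
    have h := norm_iteratedFDeriv_comp_le (g := Real.exp) (f := fun x => -wt x) (n := n) (N := ∞)
      Real.contDiff_exp hwts.neg (mod_cast le_top) x (C := Real.exp (-wt x)) (D := D)
      (fun i _ => (hexp i).le) (fun i hi hin => hDi i hi hin x)
    calc ‖iteratedFDeriv ℝ n (fun x => Real.exp (-wt x)) x‖
        = ‖iteratedFDeriv ℝ n (Real.exp ∘ fun x => -wt x) x‖ := rfl
      _ ≤ n ! * Real.exp (-wt x) * D ^ n := h
      _ = n ! * D ^ n * Real.exp (-wt x) := by ring

/-- Anchor (registered sub-stub of stub W2): the weight on `ℝ³` (closed form of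
`exists_weight`). -/
theorem w2aux_existsWeight : ∃ wt : EuclideanSpace ℝ (Fin 3) → ℝ, ContDiff ℝ ∞ wt ∧
    (∀ x, ‖x‖ - Module.finrank ℝ (EuclideanSpace ℝ (Fin 3)) ≤ wt x) ∧
    (∀ k, ∃ C, ∀ x, ‖iteratedFDeriv ℝ (k + 1) wt x‖ ≤ C) ∧
    (∀ n, ∃ C, ∀ x, ‖iteratedFDeriv ℝ n (fun x => Real.exp (-wt x)) x‖ ≤ C * Real.exp (-wt x)) :=
  exists_weight (EuclideanSpace ℝ (Fin 3))

end Summit.NavierStokesRegularity.NavierStokesRegularity.Theorems.SelfMixingDichotomy.MixingPayoffBirth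

end
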